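import Literature.MathematicalPhysics.QuantumFieldTheory.Balaban1983to89.B9Cor36GCubeRightEntryAtLocCfg
import Literature.MathematicalPhysics.QuantumFieldTheory.Balaban1983to89.B9Cor36GCubeLocAtMember

/-!
# `Balaban1983to89.B9Cor36GCubeLocAtMemberRight` — COROLLARY 3.6 p. 408 + (3.87)–(3.89) p. 409 AT ONE COVER CUBE □, READ AT THE MEMBER, BOND SECTOR: G-F6b's (3.42)-block
# `hE` of the cube letter `O_□ = M_{χ_□}R(u)⁻¹G_□(Ṽ_□)R(u)M_{χ_□}` WITH THE FLAT RIGHT ENTRY `hR` DISCHARGED by L-ASM `cor36_G_cube_rightEntry_at_locCfg` — modulo the one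
# displayed input `hDiv` of layer L-DIV (sub-row G-B9-LETTERS, module M5.1b-G, programme RIGHT-ENTRY-V, FILE F-F = the plug; cell GAPS G-B9-02 entry n = 2)

statement-level skeleton of published theorems with citation tags; proofs where landed; nothing here is a claim about the Yang–Mills mass gap

Sources under audit (cell lit-balaban): T. Bałaban, *Propagators for lattice gauge theories in a background field*, Commun. Math. Phys. **99** (1985) 389–434
[`Balaban1985BackgroundPropagators`, "B9"], Cor. 3.6 p. 408 l. 1–14, (3.87)–(3.89) p. 409, p. 410 l. 14–15, Thm 3.3 p. 399, (3.42) p. 397, Thm 3.4 p. 400, (3.86) p. 407,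
(3.31) p. 395, (3.100) p. 413; [4] = T. Bałaban, *Propagators and renormalization transformations for lattice gauge theories. II*, Commun. Math. Phys. **96** (1984)
223–250 [`Balaban1984PropagatorsII`], (2.39)–(2.44) pp. 229–230, (2.51)–(2.55) p. 232.  Unit `lit-balaban-p33` (p33 gen 102); B9 fold owner r06; referee ref-4.

## WHAT IS PRINTED (verbatim up to notation)

p. 408 Cor. 3.6 l. 7–14: «If a configuration U satisfies (3.35) with O(1)Mα₀ ≦ a₁, and Ω′₀ ⊂ □ for a cube □ of the class described in this condition, then Theorems
3.1-3.3 hold for the operators G′(U), (Q′(U)G′²(U)Q′*(U))⁻¹, G(U) constructed for the sequence {Ω′_j}»; p. 397 (3.42): «|(G′(U)λ)(x)|, |(∇_UG′(U)λ)(x)|,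
|(G′(U)∇*_Uλ)(x)|, |(Δ_UG′(U)λ)(x)| ≦ B₀[(Lʲη)², Lʲη, Lʲη, 1]e^{−δ₀d(y,y′)}|λ|»; p. 409: the operators `G_□(U)` «satisfy all the inequalities of Theorems 3.1–3.3».

## WHY THIS FILE

G-F6b `B9Cor36GCubeLocAtMember.eBlock_locLetterBY` (p38 g44, p663680) gives M5.7's per-cube input `hE` — the four (3.42) entries of `O_□` over the member's
geometry — for EVERY `B₂ ≥ 0`, `0 < ρ′ ≤ δ` carrying the flat right entry `hR : ∀ν GVK(Ṽ_□)·conj b(∇*_{1,ν}) ≺ B₂·Lⁿη·e^{−ρ′d_□}` as a hypothesis.  L-ASM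
`B9Cor36GCubeRightEntryAtLocCfg.cor36_G_cube_rightEntry_at_locCfg` (this seat, same day) PRODUCES `hR` uniformly in the member and the cube (constants `ρ_R, B₂`),
modulo the displayed left composite `hDiv` of layer L-DIV.  THIS FILE plugs one into the other: the same statement as G-F6b's with the `B₂, ρ′, hR` binders GONE and
`hDiv` displayed at the top, constants `B₀(1 + B₂)`, `(1 − 9∕5000)·min(δ, ρ_R)`.

## WHAT THIS FILE CERTIFIES (kernel-checked; one theorem; 0 `def`, 0 `def … : Prop`, 0 sorry; standard axioms)

★★★ `eBlock_locLetterBY'` — GIVEN `hDiv` (as in L-ASM): there are `δ > 0`, `B₀ ≥ 0`, thresholds `M₀, T₀, N₀`, `a₁ > 0` such that for every member above threshold,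
every cover cube □, every (3.35) cube datum `(u, U, A; Q, C, ξ, Λ)` of G-F6b's form with `sRead C Λ ≤ a₁`, `u` a bi-contraction, and every background family through
`U`: `Δ_{a,□}(Ṽ_□)` is a unit AND `EBlock (kernelFamilyBInv i B cfg (fun _ => O_□) par) B₀ δ U₁` — G-F6b's conclusion with NO right-entry hypothesis left.

## HONEST SCOPE

Pure plug (two landed∕filed theorems composed; rate `min`, thresholds `max`, size threshold `min`); the displayed inputs are G-F6b's datum and `hDiv` (layer L-DIV,
p38's lineage — print's (3.70)–(3.73) read from the input side under the p. 398 licence; NOT proved here).  NOT here: the defect majorants `locDefectBY ∕ locDefectTBY`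
(M5.1b-G item 2), uniform-`B₀` bookkeeping across cubes beyond what the ∃-prefix states (item 3).  Count-neutral; NOT a node discharge; no summit ∕ sub-problem statement
is proved; nothing continuum ∕ OS ∕ mass-gap ∕ Clay; YM mass gap NOT proved by any of this (Track A conditional rung).  No `sorry`, no `axiom`, no `… : Prop` fact, no
`instance`, no `notation`.  NEW file; nothing landed is modified.  `--supports stmt-QuantumFields-19200`.  Net new unproved facts: 0.
-/

noncomputable section

namespace Literature.MathematicalPhysics.QuantumFieldTheory.Balaban1983to89.B9Cor36GCubeLocAtMemberRight

open NormedSpace Complex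
open B6RandomWalk (HasMajorant hasMajorant_mono)
open B9Thm34Ext (toB6)
open B9Eq352DivFormLetters (conj)
open B9Eq39Adjoint (covD fluct)
open B6KLevelCensusIndexV1 (KIdx kGeo)
open B6Cover236MultiLevelBlocks (cubes)
open B6GlobalChartV1 (PV boxEquiv)
open B9BackgroundsKLevelV1 (shiftsV1)
open B6Ineq2142KLevelV1 (β)
open B9GeoNormsKLevelV1 (geo9K)
open B9FromB6 (EBlock)
open B9Eq360DeltaPrimeAY (AfldY)
open B9CubeLettersBondOpsL0 (BlkCubeY deltaACubeY)
open B9CubeGeometryInputs (geoCK geoCK_len_pos geoCK_dist_axioms RM1)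
open B9CubeLettersInvReadings (kernelFamilyBInv)
open B9Cor36CubeCutoffs (SC NearC chiY locCfgY)
open B9Cor36GCubeLocLetter (locLetterBY)
open B9Cor35GCubeInputsAtOne (blkBK GK GVK VK)
open B9Cor35CinvAtCubeLetters (kernel_rate_mono)
open B9Cor36GCubeWindows (sRead)
open B9Cor36GCubeLocAtMember (eBlock_locLetterBY)
open B9Cor36GCubeRightEntryAtLocCfg (cor36_G_cube_rightEntry_at_locCfg)
open B9CoReadingCoords (cdsBₗ)
open Node00 (SiteY BlkY IBondY FBondY CfgY GaugeY BondParY toKT gaugeY parSymY parBY)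

variable {d ℓ : ℕ} {hd : 1 ≤ d + 1} {hL : Odd (ℓ + 1) ∧ 1 < ℓ + 1} {b₀ b₁ : ℝ}
variable {𝔸 : Type} [NormedRing 𝔸] [NormedAlgebra ℂ 𝔸] [CompleteSpace 𝔸]
variable {ι : Type} [Fintype ι] (b : Module.Basis ι ℝ 𝔸)

set_option maxHeartbeats 3200000 in
/-- ★★★ **THE (3.42)-BLOCK `hE` OF THE BOND WRITER FOR THE CUBE LETTER `O_□` OF DESIGN (R), BOND SECTOR — G-F6b's `eBlock_locLetterBY` WITH THE FLAT RIGHT ENTRY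
DISCHARGED** (Corollary 3.6 at one cover cube, read at the member; the `hE` input of `B9Thm310DeltaAIsUnitOfExpansion.eBlock_kernelFamilyBInv_GAY_of_localInverseCubes''`
per cube), MODULO the displayed left composite `hDiv` of layer L-DIV (`GK·VK(Ṽ_□) ≺ κ_D·s·e^{−ρ_Dd}`, r06's `hGV` slot at the cube letters): there are a rate `δ > 0`, a
constant `B₀ ≥ 0`, thresholds `M₀, N₀, T₀` and `a₁ > 0` such that for every member above threshold, every cover cube □, every (3.35) cube datum `(u, U, A; Q, C, ξ, Λ)`
of G-F6b's form with `sRead C Λ ≤ a₁`, `u` a bi-contraction and every background family through `U`: `Δ_{a,□}(Ṽ_□)` is a unit AND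
`EBlock (kernelFamilyBInv i B cfg (fun _ => O_□) par) B₀ δ U₁` — the four (3.42) entries of `O_□ = locLetterBY i □ parSymY parBY u χ_□ Ṽ_□` over the member's geometry.
PROOF: L-ASM's `hR` at `(ρ_R, B₂)`, rate-weakened to `ρ′ := min(δ₆, ρ_R)`, fed to G-F6b. [cite: Balaban1985BackgroundPropagators, Cor. 3.6 p.408 l.1–14, (3.87)–(3.89) p.409, p.410 l.14–15, Thm 3.3 p.399 with Thm 3.1 (3.42) p.397, Thm 3.4 p.400, (3.86) p.407, (3.31) p.395, (3.100) p.413; Balaban1984PropagatorsII, (2.39)–(2.44) pp.229–230, (2.51)–(2.55) p.232] -/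
theorem eBlock_locLetterBY' [NormOneClass 𝔸] [DecidableEq ι] (hℓ : 1 ≤ ℓ) (hb₀ : 0 < b₀) (hb₁ : b₀ ≤ b₁) (M₂ : ℝ) (hM₂ : 0 ≤ M₂)
    (hrepr : ∀ (v : 𝔸) (j : ι), |b.repr v j| ≤ M₂ * ‖v‖)
    {ρD κD MD TD aD : ℝ} {ND : ℕ} (hρD : 0 < ρD) (hκD : 0 ≤ κD) (haD : 0 < aD)
    (hDiv : ∀ (i : KIdx d ℓ hd hL b₀ b₁) (c : ↥(cubes (toKT i).D.toDomains)) (Rr : ℝ) (H : Prop),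
      MD ≤ ((ℓ : ℝ) + 1) * (toKT i).Mh → ND + 1 ≤ (toKT i).R * ((ℓ + 1) * (toKT i).Mh) → TD ≤ RM1 i →
      ∀ (A : AfldY 𝔸 i) (Q : Set (Site (PV d ℓ i.m i.K hd hL) 0)) (C ξ Λ : ℝ),
      0 ≤ C → 0 < ξ → 1 ≤ Λ → ξ ≤ 5 * (SC i c : ℝ) * (kGeo i).eta → LatticeNorms.scaleLen ((ℓ : ℝ) + 1) (kGeo i).eta (c.1.1 + 1) ≤ Λ * ξ →
      (∀ x : Site (PV d ℓ i.m i.K hd hL) 0, NearC i c (35 * SC i c / 8 + 1) (boxEquiv i.hN x).1 → x ∈ Q) →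
      (∀ κ, ∀ x ∈ Q, ‖A κ x‖ ≤ C * ξ⁻¹) →
      (∀ μ ν, ∀ x ∈ Q, ‖(((kGeo i).eta : ℂ)⁻¹) • covD (shiftsV1 (PV d ℓ i.m i.K hd hL)) (fun _ _ => (1 : 𝔸ˣ)) μ (A ν) x‖ ≤ C * (ξ ^ 2)⁻¹) →
      (∀ (t : ℝ) (κ : Fin (d + 1)) (x : Site (PV d ℓ i.m i.K hd hL) 0), ‖NormedSpace.exp ((I * (t : ℂ)) • A κ x)‖ ≤ 1) →
      sRead C Λ ≤ aD →
      HasMajorant (g := toB6 (geoCK i c) Rr H) (blkBK i c)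
        (GK b i c (parSymY i) (parBY i) * VK b i c (parSymY i) (parBY i) (locCfgY i c (kGeo i).eta A))
        (fun a a' => κD * sRead C Λ * Real.exp (-(ρD * (geoCK i c).dist a a')))) :
    ∃ δ B₀ M₀ T₀ : ℝ, ∃ N₀ : ℕ, 0 < δ ∧ 0 ≤ B₀ ∧ ∃ a₁ : ℝ, 0 < a₁ ∧
    ∀ (i : KIdx d ℓ hd hL b₀ b₁) (c : ↥(cubes (toKT i).D.toDomains)),
      M₀ ≤ ((ℓ : ℝ) + 1) * (toKT i).Mh → N₀ + 1 ≤ (toKT i).R * ((ℓ + 1) * (toKT i).Mh) → T₀ ≤ RM1 i →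
    ∀ (u : GaugeY 𝔸 i) (U : CfgY 𝔸 i) (A : AfldY 𝔸 i) (Q : Set (Site (PV d ℓ i.m i.K hd hL) 0)) (C ξ Λ : ℝ),
      0 ≤ C → 0 < ξ → 1 ≤ Λ → ξ ≤ 5 * (SC i c : ℝ) * (kGeo i).eta → LatticeNorms.scaleLen ((ℓ : ℝ) + 1) (kGeo i).eta (c.1.1 + 1) ≤ Λ * ξ →
      (∀ x : Site (PV d ℓ i.m i.K hd hL) 0, NearC i c (35 * SC i c / 8 + 1) (boxEquiv i.hN x).1 → x ∈ Q) →
      (∀ (κ : Fin (d + 1)) (x : Site (PV d ℓ i.m i.K hd hL) 0), x ∈ Q → x.shift κ ∈ Q → gaugeY i u U κ x = fluct (kGeo i).eta A κ x) →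
      (∀ κ, ∀ x ∈ Q, ‖A κ x‖ ≤ C * ξ⁻¹) →
      (∀ μ ν, ∀ x ∈ Q, ‖(((kGeo i).eta : ℂ)⁻¹) • covD (shiftsV1 (PV d ℓ i.m i.K hd hL)) (fun _ _ => (1 : 𝔸ˣ)) μ (A ν) x‖ ≤ C * (ξ ^ 2)⁻¹) →
      (∀ (t : ℝ) (κ : Fin (d + 1)) (x : Site (PV d ℓ i.m i.K hd hL) 0), ‖NormedSpace.exp ((Complex.I * (t : ℂ)) • A κ x)‖ ≤ 1) →
      sRead C Λ ≤ a₁ →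
      (∀ x, ‖((u x : 𝔸ˣ) : 𝔸)‖ ≤ 1 ∧ ‖(((u x)⁻¹ : 𝔸ˣ) : 𝔸)‖ ≤ 1) →
    ∀ [Fintype (geo9K i).Site] (ιB : BlkY i → IBondY i) (_ : ∀ s, β i.hN i.D i.hk (ιB s) = s) (Rr : ℝ) (Hp : Prop)
      {B : B9.Backgrounds} (cfg : B.Cfg → CfgY 𝔸 i) (par : BondParY 𝔸 i) (U₁ : B.Cfg), cfg U₁ = U →
      IsUnit (deltaACubeY i c (parSymY i) (parBY i) (locCfgY i c (kGeo i).eta A)) ∧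
      EBlock (kernelFamilyBInv i B cfg (fun _ => locLetterBY i c (parSymY i) (parBY i) u (chiY i c) (locCfgY i c (kGeo i).eta A)) par) B₀ δ U₁ := by
  -- G-F6b: `hE` modulo `hR`
  obtain ⟨δ₆, B₆, M₆, T₆, N₆, hδ₆, hB₆, a₆, ha₆, h6⟩ := eBlock_locLetterBY b hℓ hb₀ hb₁ M₂ hM₂ hrepr
  -- L-ASM: `hR` modulo `hDiv`
  obtain ⟨ρR, B₂, MR, TR, NR, hρR, hB₂, aR, haR, hR⟩ := cor36_G_cube_rightEntry_at_locCfg b hℓ hb₀ hb₁ M₂ hM₂ hrepr hρD hκD haD hDiv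
  set ρ' : ℝ := min δ₆ ρR with hρ'def
  have hρ' : 0 < ρ' := lt_min hδ₆ hρR
  have hρ'δ : ρ' ≤ δ₆ := min_le_left _ _
  have hρ'R : ρ' ≤ ρR := min_le_right _ _
  refine ⟨(1 - 9 / 5000) * ρ', B₆ * (1 + B₂), max M₆ MR, max T₆ TR, max N₆ NR, by positivity, by positivity, min a₆ aR, lt_min ha₆ haR, ?_⟩
  intro i c hM hN hT u U A Q C ξ Λ hC hξ hΛ hξS hΛξ hQ hgA hA hdA hAu hsa hg _ ιB hι Rr Hp B cfg par U₁ hcfg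
  have hM₆ : M₆ ≤ ((ℓ : ℝ) + 1) * (toKT i).Mh := (le_max_left _ _).trans hM
  have hMR : MR ≤ ((ℓ : ℝ) + 1) * (toKT i).Mh := (le_max_right _ _).trans hM
  have hN₆ : N₆ + 1 ≤ (toKT i).R * ((ℓ + 1) * (toKT i).Mh) := le_trans (Nat.succ_le_succ (le_max_left _ _)) hN
  have hNR : NR + 1 ≤ (toKT i).R * ((ℓ + 1) * (toKT i).Mh) := le_trans (Nat.succ_le_succ (le_max_right _ _)) hN
  have hT₆ : T₆ ≤ RM1 i := (le_max_left _ _).trans hT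
  have hTR : TR ≤ RM1 i := (le_max_right _ _).trans hT
  have hs₆ : sRead C Λ ≤ a₆ := hsa.trans (min_le_left _ _)
  have hsR : sRead C Λ ≤ aR := hsa.trans (min_le_right _ _)
  obtain ⟨hdnn, -, -, -⟩ := geoCK_dist_axioms i c Rr Hp
  -- the right entry at `(ρ_R, B₂)`, rate-weakened to `ρ′`
  have hRν : ∀ ν : Fin (d + 1), HasMajorant (g := toB6 (geoCK i c) Rr Hp) (blkBK i c)
      (GVK b i c (parSymY i) (parBY i) (locCfgY i c (kGeo i).eta A) * conj b (cdsBₗ i (fun _ _ => (1 : 𝔸ˣ)) ν))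
      (fun a a' => B₂ * (geoCK i c).len a * Real.exp (-(ρ' * (geoCK i c).dist a a'))) := fun ν =>
    hasMajorant_mono (g := toB6 (geoCK i c) Rr Hp) _ (hR i c Rr Hp hMR hNR hTR A Q C ξ Λ hC hξ hΛ hξS hΛξ hQ hA hdA hAu hsR ν) fun a a' =>
      kernel_rate_mono hdnn hρ'R (mul_nonneg hB₂ (geoCK_len_pos i c a).le) a a'
  exact h6 i c hM₆ hN₆ hT₆ u U A Q C ξ Λ hC hξ hΛ hξS hΛξ hQ hgA hA hdA hAu hs₆ hg ιB hι Rr Hp cfg par U₁ hcfg B₂ ρ' hB₂ hρ' hρ'δ hRν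

end Literature.MathematicalPhysics.QuantumFieldTheory.Balaban1983to89.B9Cor36GCubeLocAtMemberRight

end
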